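import Literature.Analysis.Calculus.SqrtEnergyCalculus
import Mathlib.Analysis.SpecialFunctions.Pow.Real
import HarnessLib

/-!
# The algebra of Waldron's `f₁`-inequality (`□ f₁ ≤ C e f / r²`)

Analysis support file (everything proved; no definitions, no named facts) for A. Waldron, Invent.
math. 217 (2019), §4.2, (4.8)–(4.11): the passage from the integrated sphere identity
`r² ∂ₜq = −2X + (S₂ − 2R) + 3P + 2r² Nℓ` (`q = f₁²/r²`, `X` the angular energy, `R` the radial
energy, `P = r q'`, `S₂ = r² q''`-datum), the spectral gap `3q ≤ (1+κ)X + 304κq` and the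
Cauchy–Schwarz bound `P² ≤ 4 q R` to the differential inequality for the regularized
`ψ = √(q + δ)` and `F₁ = r ψ`:

* `gap_lower_bound` — `X ≥ (3 − 307κ) q` (`0 ≤ κ ≤ 1`);
* `neg_energy_div_sqrt_le` — `−(3 − 307κ) q/ψ ≤ −(3 − 307κ) ψ + 3√δ`;
* `psi_heat_inequality` — **`r² ψₜ ≤ r² ψ'' + 3 r ψ' − (3 − 307κ) ψ + 3√δ + r²|Nℓ|/ψ`** with
  `ψₜ = V/(2ψ)`, `ψ' = a/ψ`, `ψ'' = (b + c)/ψ − a²/ψ³`, `a = P/(2r)`, `b = R/r²`, `c = (S₂ − 2R)/(2r²)`;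
* `F1_heat_inequality` — the same for `F₁ = rψ`:
  `F₁ₜ ≤ F₁'' + F₁'/r − (4 − 307κ) F₁/r² + 3√δ/r + r|Nℓ|/ψ`.

References: A. Waldron, Invent. math. 217 (2019), §4.2 [Waldron2019]; J. Råde, J. reine angew.
Math. 431 (1992) [folklore].
-/

noncomputable section

open Real

namespace Literature.Analysis.Calculus

/-- **The gap in usable form**: from `3q ≤ (1+κ)X + 304κq`, `0 ≤ κ ≤ 1`, `0 ≤ q`, `0 ≤ X`:
`(3 − 307κ) q ≤ X`. [folklore] -/
theorem gap_lower_bound {q X κ : ℝ} (hq : 0 ≤ q) (hX : 0 ≤ X) (hκ0 : 0 ≤ κ)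
    (hgap : 3 * q ≤ (1 + κ) * X + 304 * κ * q) : (3 - 307 * κ) * q ≤ X := by
  by_cases hk : 0 ≤ 3 - 304 * κ
  · -- `X ≥ (3 − 304κ) q/(1+κ) ≥ (3 − 304κ)(1 − κ) q ≥ (3 − 307κ) q`
    have h1 : (3 - 304 * κ) * q ≤ (1 + κ) * X := by nlinarith
    nlinarith [mul_nonneg hk hq, mul_nonneg hκ0 hX, mul_nonneg hκ0 hq]
  · have hneg : (3 - 307 * κ) * q ≤ 0 := by
      have : 3 - 307 * κ ≤ 0 := by linarith [not_le.1 hk]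
      exact mul_nonpos_of_nonpos_of_nonneg this hq
    linarith

/-- **`−m q/ψ ≤ −m ψ + 3√δ`** for `ψ = √(q + δ)`, `m ≤ 3`, `q ≥ 0`, `δ > 0`. [folklore] -/
theorem neg_energy_div_sqrt_le {q δ m : ℝ} (hq : 0 ≤ q) (hδ : 0 < δ) (hm : m ≤ 3) :
    -(m * q / √(q + δ)) ≤ -(m * √(q + δ)) + 3 * √δ := by
  have hψ : 0 < √(q + δ) := Real.sqrt_pos.2 (by linarith)
  have hψ2 : (√(q + δ)) ^ 2 = q + δ := Real.sq_sqrt (by linarith)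
  have hsδ : 0 ≤ √δ := Real.sqrt_nonneg _
  have hδψ : √δ ≤ √(q + δ) := Real.sqrt_le_sqrt (by linarith)
  have hsδ2 : (√δ) ^ 2 = δ := Real.sq_sqrt hδ.le
  by_cases hm0 : 0 ≤ m
  · -- `q/ψ = ψ − δ/ψ` and `δ/ψ ≤ √δ`
    have hq_eq : q / √(q + δ) = √(q + δ) - δ / √(q + δ) := by
      field_simp; nlinarith
    have hδle : δ / √(q + δ) ≤ √δ := by
      rw [div_le_iff₀ hψ]; nlinarith
    rw [mul_div_assoc, hq_eq]
    nlinarith [mul_le_mul_of_nonneg_left hδle hm0]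
  · have hmneg : m < 0 := not_le.1 hm0
    -- `q/ψ ≤ ψ`, multiplied by `−m ≥ 0`
    have hqψ : q / √(q + δ) ≤ √(q + δ) := by
      rw [div_le_iff₀ hψ]; nlinarith
    have h2 : (-m) * (q / √(q + δ)) ≤ (-m) * √(q + δ) := mul_le_mul_of_nonneg_left hqψ (by linarith)
    have h3 : -(m * q / √(q + δ)) = (-m) * (q / √(q + δ)) := by ring
    rw [h3]
    nlinarith

/-- **The `ψ`-inequality.** Inputs: `r > 0`, `δ > 0`, `q ≥ 0`, `X, R ≥ 0`, `0 ≤ κ ≤ 1`, the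
identity `r² V = −2X + (S₂ − 2R) + 3P + 2r²Nℓ`, the gap `3q ≤ (1+κ)X + 304κq` (`κ ≥ 0`) and
Cauchy–Schwarz `P² ≤ 4 q R`. With `ψ = √(q+δ)`, `a = P/(2r)`, `b = R/r²`, `c = (S₂ − 2R)/(2r²)`:
`r² (V/(2ψ)) ≤ r² ((b + c)/ψ − a²/ψ³) + 3 r (a/ψ) − (3 − 307κ) ψ + 3√δ + r²|Nℓ|/ψ`. [folklore] -/
theorem psi_heat_inequality {r δ q X R P S2 Nl V κ : ℝ} (hr : 0 < r) (hδ : 0 < δ) (hq : 0 ≤ q)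
    (hX : 0 ≤ X) (hR : 0 ≤ R) (hκ0 : 0 ≤ κ)
    (hid : r ^ 2 * V = -2 * X + (S2 - 2 * R) + 3 * P + 2 * r ^ 2 * Nl)
    (hgap : 3 * q ≤ (1 + κ) * X + 304 * κ * q) (hCS : P ^ 2 ≤ 4 * q * R) :
    r ^ 2 * (V / (2 * √(q + δ))) ≤
      r ^ 2 * (((R / r ^ 2) + (S2 - 2 * R) / (2 * r ^ 2)) / √(q + δ) - (P / (2 * r)) ^ 2 / (√(q + δ)) ^ 3) +
        3 * r * ((P / (2 * r)) / √(q + δ)) - (3 - 307 * κ) * √(q + δ) + 3 * √δ + r ^ 2 * |Nl| / √(q + δ) := by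
  have hψ : 0 < √(q + δ) := Real.sqrt_pos.2 (by linarith)
  set ψ := √(q + δ) with hψ_def
  -- Råde: `c ≤ ψ ψ''`
  have hcs' : (P / (2 * r)) ^ 2 ≤ q * (R / r ^ 2) := by
    rw [div_pow]
    have hr2 : 0 < r ^ 2 := by positivity
    rw [div_le_iff₀ (by positivity : (0 : ℝ) < (2 * r) ^ 2)]
    calc P ^ 2 ≤ 4 * q * R := hCS
      _ = q * (R / r ^ 2) * (2 * r) ^ 2 := by field_simp; ring
  have hrade := sqrt_energy_mul_deriv2_ge (c := (S2 - 2 * R) / (2 * r ^ 2)) hq (by positivity : 0 ≤ R / r ^ 2) hδ hcs'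
  -- the gap
  have hXq := gap_lower_bound hq hX hκ0 hgap
  have hgapψ := neg_energy_div_sqrt_le (m := 3 - 307 * κ) hq hδ (by linarith)
  -- rewrite `r² V/(2ψ)` through the identity
  have hV : r ^ 2 * (V / (2 * ψ)) = (-X + r ^ 2 * ((S2 - 2 * R) / (2 * r ^ 2)) + 3 * r * (P / (2 * r)) + r ^ 2 * Nl) / ψ := by
    have hr2 : r ^ 2 ≠ 0 := by positivity
    field_simp
    nlinarith [hid]
  rw [hV]
  -- compare term by term after dividing by `ψ`
  have hXψ : -X / ψ ≤ -((3 - 307 * κ) * q / ψ) := by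
    rw [neg_div, neg_le_neg_iff]
    exact div_le_div_of_nonneg_right hXq hψ.le
  have hNl : r ^ 2 * Nl / ψ ≤ r ^ 2 * |Nl| / ψ :=
    div_le_div_of_nonneg_right (mul_le_mul_of_nonneg_left (le_abs_self _) (by positivity)) hψ.le
  have hc : r ^ 2 * ((S2 - 2 * R) / (2 * r ^ 2)) / ψ ≤
      r ^ 2 * (((R / r ^ 2) + (S2 - 2 * R) / (2 * r ^ 2)) / ψ - (P / (2 * r)) ^ 2 / ψ ^ 3) := by
    -- `c/ψ ≤ ψ''` from `c ≤ ψ ψ''`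
    have h1 : (S2 - 2 * R) / (2 * r ^ 2) / ψ ≤ ((R / r ^ 2) + (S2 - 2 * R) / (2 * r ^ 2)) / ψ - (P / (2 * r)) ^ 2 / ψ ^ 3 := by
      rw [div_le_iff₀ hψ]
      linarith [hrade]
    have := mul_le_mul_of_nonneg_left h1 (by positivity : (0 : ℝ) ≤ r ^ 2)
    rwa [← mul_div_assoc] at this
  have hsplit : (-X + r ^ 2 * ((S2 - 2 * R) / (2 * r ^ 2)) + 3 * r * (P / (2 * r)) + r ^ 2 * Nl) / ψ =
      -X / ψ + r ^ 2 * ((S2 - 2 * R) / (2 * r ^ 2)) / ψ + 3 * r * ((P / (2 * r)) / ψ) + r ^ 2 * Nl / ψ := by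
    field_simp
  rw [hsplit]
  linarith

/-- **The `F₁`-inequality** (`F₁ = r ψ`): with `F₁ₜ = r ψₜ`, `F₁' = ψ + r ψ'`, `F₁'' = 2ψ' + r ψ''`,
`F₁ₜ ≤ F₁'' + F₁'/r − (4 − 307κ) F₁/r² + 3√δ/r + r |Nℓ|/ψ`. [folklore] -/
theorem F1_heat_inequality {r ψ ψt ψ1 ψ2 κ δs E : ℝ} (hr : 0 < r)
    (h : r ^ 2 * ψt ≤ r ^ 2 * ψ2 + 3 * r * ψ1 - (3 - 307 * κ) * ψ + δs + E) :
    r * ψt ≤ (2 * ψ1 + r * ψ2) + (ψ + r * ψ1) / r - (4 - 307 * κ) * (r * ψ) / r ^ 2 + δs / r + E / r := by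
  have hr0 : r ≠ 0 := hr.ne'
  have key : r * ψt * r ≤ ((2 * ψ1 + r * ψ2) + (ψ + r * ψ1) / r - (4 - 307 * κ) * (r * ψ) / r ^ 2 + δs / r + E / r) * r := by
    have e1 : ((2 * ψ1 + r * ψ2) + (ψ + r * ψ1) / r - (4 - 307 * κ) * (r * ψ) / r ^ 2 + δs / r + E / r) * r =
        r ^ 2 * ψ2 + 3 * r * ψ1 - (3 - 307 * κ) * ψ + δs + E := by
      field_simp; ring
    rw [e1]; nlinarith
  exact le_of_mul_le_mul_right key hr

end Literature.Analysis.Calculus
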